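import Literature.MathematicalPhysics.QuantumLattice.SectorPropagatorFourier
import Literature.MathematicalPhysics.QuantumLattice.SectorWeightRelativeAngle
import Literature.Analysis.SpecialFunctions.SmoothTruncatedArg
import Literature.Analysis.Calculus.SlopeQuotient
import HarnessLib

/-!
# The anisotropic chart as a smooth family down to scale zero; the rescaled dispersion and angle
(Benfatto–Giuliani–Mastropietro 2006, Lemma 2.2: the `h`-uniform symbol estimates, part 1)

Topic `Literature/MathematicalPhysics/QuantumLattice`; continues `SectorPropagatorFourier.lean`
(Lemma 2.2 is reduced to an `h`-uniform Fourier-decay estimate of the rescaled symbol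
`t ↦ sectorSymbolE(q_F + sectorChart t)`). The strategy for the `h`-uniform estimates is to
exhibit the rescaled symbol as the value at `s = 2^{-n} = γ^{h/2}` of a function SMOOTH IN `s`
DOWN TO `s = 0`, so that its derivatives are bounded on compact sets (no Faà di Bruno bookkeeping).
This file provides the smooth family of charts and the two singularly rescaled quantities,
written as smooth difference quotients in `s` (`Analysis/Calculus/SlopeQuotient`):

* `sectorChartPoint μ (θ₀, a, b) s = p_F(θ₀) + s² a n(θ₀) + s b τ(θ₀)` — smooth in all variables
  (`contDiff_uncurry_sectorChartPoint`), `sectorChartPoint … 0 = p_F(θ₀)`; its frame coordinates are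
  `(s²a, sb)` (`normalCoord_sectorChartPoint`, `tangentCoord_sectorChartPoint`); at `s = 2^{-n}` it is the
  spatial part of `q_F + sectorChart t` (`splitMomentum_fermiBasePoint_add_sectorChart`);
* `sectorEpsFun μ ((θ₀,a,b), s) = ε(sectorChartPoint) - μ` vanishes to SECOND order at `s = 0`
  (`sectorEpsFun_zero`: `p_F` lies on the Fermi curve; `fderiv_sectorEpsFun_zero`: `τ ⊥ ∇ε`, the tangency
  (2.53)), hence `ε(k) - μ = s² Ẽ` with `Ẽ = rescaledDispersion μ = slopeQuot (slopeQuot sectorEpsFun)`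
  smooth (`sectorEpsFun_eq_sq_mul_rescaledDispersion`) — the `γ^{-h}(E_h(k⃗) - μ) = O(1)` of BGM;
* `sectorUFun μ (θ₀,a,b) s = (k₁ + ik₂) e^{-iθ₀}` at `k = sectorChartPoint`, `sectorUFun … 0 = u(θ₀) > 0`;
  `sectorAngFun μ = truncArg r c₁ c₂ ∘ sectorUFun` (the globally smooth truncated relative angle,
  `Analysis/SpecialFunctions/SmoothTruncatedArg`, radius `r = ½√((4+μ)/2)`, cut levels
  `cos(7π/8)`, `cos(15π/16)`) vanishes at `s = 0`, hence `sectorAngFun = s Ã` with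
  `Ã = rescaledAngle μ = slopeQuot sectorAngFun` smooth (`sectorAngFun_eq_mul_rescaledAngle`) — the
  `γ^{-h/2}(θ(k⃗) - θ_{h,ω}) = O(1)` of BGM.

Everything is PROVED; the definitions are `sectorChartPoint`, `sectorEpsFun`, `rescaledDispersion`,
`truncRadius`, `sectorUFun`, `sectorAngFun`, `rescaledAngle`.

## Sources

* G. Benfatto, A. Giuliani, V. Mastropietro, Ann. Henri Poincaré 7 (2006) 809–898, §2.5
  (2.46)–(2.54), Lemma 2.2 (arXiv:cond-mat/0507686 pp. 10–11). [BenfattoGiulianiMastropietro2006]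
* G. Benfatto, A. Giuliani, V. Mastropietro, Ann. Henri Poincaré 4 (2003) 137–193, §7.2.
  [BenfattoGiulianiMastropietro2003]
-/

noncomputable section

open Real Set Complex Function
open scoped Topology ContDiff
open Literature.Analysis.Calculus Literature.Analysis.SpecialFunctions

namespace Literature.MathematicalPhysics.QuantumLattice

/-! ### The chart point -/

/-- **The chart point** `k(θ₀, a, b; s) = p_F(θ₀) + s² a n(θ₀) + s b τ(θ₀)`. [cite: BenfattoGiulianiMastropietro2006, §2.5 (2.46)] -/
def sectorChartPoint (μ : ℝ) (x : ℝ × ℝ × ℝ) (s : ℝ) : Fin 2 → ℝ :=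
  ![fermiX μ x.1 + s ^ 2 * x.2.1 * fermiNormal μ x.1 0 + s * x.2.2 * fermiTangent μ x.1 0,
    fermiY μ x.1 + s ^ 2 * x.2.1 * fermiNormal μ x.1 1 + s * x.2.2 * fermiTangent μ x.1 1]

/-- Components of the chart point. [folklore] -/
@[simp] theorem sectorChartPoint_apply_zero (μ : ℝ) (x : ℝ × ℝ × ℝ) (s : ℝ) :
    sectorChartPoint μ x s 0 = fermiX μ x.1 + s ^ 2 * x.2.1 * fermiNormal μ x.1 0 + s * x.2.2 * fermiTangent μ x.1 0 := rfl

/-- Components of the chart point. [folklore] -/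
@[simp] theorem sectorChartPoint_apply_one (μ : ℝ) (x : ℝ × ℝ × ℝ) (s : ℝ) :
    sectorChartPoint μ x s 1 = fermiY μ x.1 + s ^ 2 * x.2.1 * fermiNormal μ x.1 1 + s * x.2.2 * fermiTangent μ x.1 1 := rfl

/-- At `s = 0` the chart point is the Fermi point. [folklore] -/
theorem sectorChartPoint_zero (μ : ℝ) (x : ℝ × ℝ × ℝ) : sectorChartPoint μ x 0 = ![fermiX μ x.1, fermiY μ x.1] := by
  ext i; fin_cases i <;> simp

section Smooth

variable {μ : ℝ} (hμ₁ : -4 < μ) (hμ₂ : μ < -2 - Real.sqrt 2)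
include hμ₁ hμ₂

/-- `θ ↦ x(θ)` is smooth. [folklore] -/
theorem contDiff_fermiX : ContDiff ℝ ∞ (fermiX μ) :=
  (contDiff_fermiRadius hμ₁ hμ₂).mul Real.contDiff_cos

/-- `θ ↦ y(θ)` is smooth. [folklore] -/
theorem contDiff_fermiY : ContDiff ℝ ∞ (fermiY μ) :=
  (contDiff_fermiRadius hμ₁ hμ₂).mul Real.contDiff_sin

/-- `θ ↦ x'(θ)` is smooth. [folklore] -/
theorem contDiff_fermiVX : ContDiff ℝ ∞ (fermiVX μ) :=
  ((contDiff_fermiRadiusDeriv hμ₁ hμ₂).mul Real.contDiff_cos).sub ((contDiff_fermiRadius hμ₁ hμ₂).mul Real.contDiff_sin)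

/-- `θ ↦ y'(θ)` is smooth. [folklore] -/
theorem contDiff_fermiVY : ContDiff ℝ ∞ (fermiVY μ) :=
  ((contDiff_fermiRadiusDeriv hμ₁ hμ₂).mul Real.contDiff_sin).add ((contDiff_fermiRadius hμ₁ hμ₂).mul Real.contDiff_cos)

/-- `θ ↦ s'(θ)` is smooth (it is positive). [folklore] -/
theorem contDiff_fermiSpeed : ContDiff ℝ ∞ (fermiSpeed μ) := by
  unfold fermiSpeed
  refine ContDiff.sqrt (((contDiff_fermiRadius hμ₁ hμ₂).pow 2).add ((contDiff_fermiRadiusDeriv hμ₁ hμ₂).pow 2)) fun θ => ?_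
  have := fermiRadius_pos hμ₁ hμ₂ θ
  positivity

/-- The components of `n(θ)` are smooth. [folklore] -/
theorem contDiff_fermiNormal_apply (i : Fin 2) : ContDiff ℝ ∞ fun θ => fermiNormal μ θ i := by
  have hinv : ContDiff ℝ ∞ fun θ => (fermiSpeed μ θ)⁻¹ :=
    (contDiff_fermiSpeed hμ₁ hμ₂).inv fun θ => (fermiSpeed_pos hμ₁ hμ₂ θ).ne'
  fin_cases i
  · simpa [fermiNormal] using hinv.mul (contDiff_fermiVY hμ₁ hμ₂)
  · simpa [fermiNormal] using hinv.mul (contDiff_fermiVX hμ₁ hμ₂).neg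

/-- The components of `τ(θ)` are smooth. [folklore] -/
theorem contDiff_fermiTangent_apply (i : Fin 2) : ContDiff ℝ ∞ fun θ => fermiTangent μ θ i := by
  have hinv : ContDiff ℝ ∞ fun θ => (fermiSpeed μ θ)⁻¹ :=
    (contDiff_fermiSpeed hμ₁ hμ₂).inv fun θ => (fermiSpeed_pos hμ₁ hμ₂ θ).ne'
  fin_cases i
  · simpa [fermiTangent] using hinv.mul (contDiff_fermiVX hμ₁ hμ₂)
  · simpa [fermiTangent] using hinv.mul (contDiff_fermiVY hμ₁ hμ₂)

/-- **The chart point depends smoothly on `(θ₀, a, b, s)`.** [folklore] -/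
theorem contDiff_uncurry_sectorChartPoint : ContDiff ℝ ∞ (uncurry (sectorChartPoint μ)) := by
  have hθ : ContDiff ℝ ∞ fun p : (ℝ × ℝ × ℝ) × ℝ => p.1.1 := contDiff_fst.comp contDiff_fst
  have ha : ContDiff ℝ ∞ fun p : (ℝ × ℝ × ℝ) × ℝ => p.1.2.1 := contDiff_fst.comp (contDiff_snd.comp contDiff_fst)
  have hb : ContDiff ℝ ∞ fun p : (ℝ × ℝ × ℝ) × ℝ => p.1.2.2 := contDiff_snd.comp (contDiff_snd.comp contDiff_fst)
  have hs : ContDiff ℝ ∞ fun p : (ℝ × ℝ × ℝ) × ℝ => p.2 := contDiff_snd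
  refine contDiff_pi.2 fun i => ?_
  fin_cases i
  · simp only [uncurry, sectorChartPoint_apply_zero, Fin.zero_eta]
    exact (((contDiff_fermiX hμ₁ hμ₂).comp hθ).add (((hs.pow 2).mul ha).mul ((contDiff_fermiNormal_apply hμ₁ hμ₂ 0).comp hθ))).add
      ((hs.mul hb).mul ((contDiff_fermiTangent_apply hμ₁ hμ₂ 0).comp hθ))
  · simp only [uncurry, sectorChartPoint_apply_one, Fin.mk_one]
    exact (((contDiff_fermiY hμ₁ hμ₂).comp hθ).add (((hs.pow 2).mul ha).mul ((contDiff_fermiNormal_apply hμ₁ hμ₂ 1).comp hθ))).add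
      ((hs.mul hb).mul ((contDiff_fermiTangent_apply hμ₁ hμ₂ 1).comp hθ))

/-- **Frame coordinates of the chart point**: `k'₁ = s² a`. [cite: BenfattoGiulianiMastropietro2006, §2.5 (2.46)] -/
theorem normalCoord_sectorChartPoint (x : ℝ × ℝ × ℝ) (s : ℝ) : normalCoord μ x.1 (sectorChartPoint μ x s) = s ^ 2 * x.2.1 := by
  have hn := fermiNormal_normSq hμ₁ hμ₂ x.1
  have ht := fermiTangent_dot_fermiNormal μ x.1
  simp only [normalCoord, sectorChartPoint_apply_zero, sectorChartPoint_apply_one]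
  linear_combination (s ^ 2 * x.2.1) * hn + (s * x.2.2) * ht

/-- **Frame coordinates of the chart point**: `k'₂ = s b`. [cite: BenfattoGiulianiMastropietro2006, §2.5 (2.46)] -/
theorem tangentCoord_sectorChartPoint (x : ℝ × ℝ × ℝ) (s : ℝ) : tangentCoord μ x.1 (sectorChartPoint μ x s) = s * x.2.2 := by
  have hτ := fermiTangent_normSq hμ₁ hμ₂ x.1
  have ht := fermiTangent_dot_fermiNormal μ x.1
  simp only [tangentCoord, sectorChartPoint_apply_zero, sectorChartPoint_apply_one]
  linear_combination (s * x.2.2) * hτ + (s ^ 2 * x.2.1) * ht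

/-- **The chart of `SectorPropagatorFourier` at scale `n`**: the momentum `q_F + sectorChart t` splits
as `(4^{-n} t₀, sectorChartPoint μ (θ₀, t₁, t₂) (2^{-n}))`. [folklore] -/
theorem splitMomentum_fermiBasePoint_add_sectorChart (θ₀ : ℝ) (n : ℕ) (t : MomSpace) :
    splitMomentum (fermiBasePoint μ θ₀ + sectorChart hμ₁ hμ₂ θ₀ n t) =
      ((4 : ℝ) ^ (-(n : ℤ)) * t 0, sectorChartPoint μ (θ₀, t 1, t 2) ((2 : ℝ) ^ (-(n : ℤ)))) := by
  have h42 : ((2 : ℝ) ^ (-(n : ℤ))) ^ 2 = (4 : ℝ) ^ (-(n : ℤ)) := by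
    rw [← zpow_natCast, ← zpow_mul, show (4 : ℝ) = 2 ^ (2 : ℤ) by norm_num, ← zpow_mul]
    congr 1; ring
  rw [splitMomentum_apply, sectorChart_apply, fermiBasePoint]
  refine Prod.ext ?_ ?_
  · simp
  · ext i
    fin_cases i
    · simp only [Fin.zero_eta, Fin.isValue, Matrix.cons_val_zero, sectorChartPoint_apply_zero, PiLp.add_apply,
        Matrix.cons_val_one, Matrix.cons_val_two, Matrix.tail_cons, Matrix.head_cons]
      rw [h42]; ring
    · simp only [Fin.mk_one, Fin.isValue, Matrix.cons_val_one, Matrix.cons_val_zero, sectorChartPoint_apply_one,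
        PiLp.add_apply, Matrix.cons_val_two, Matrix.tail_cons, Matrix.head_cons]
      rw [h42]; ring

end Smooth

/-! ### The rescaled dispersion -/

/-- `sectorEpsFun μ ((θ₀,a,b), s) = ε(k(θ₀,a,b; s)) - μ`. [cite: BenfattoGiulianiMastropietro2006, §2.5 (2.49)] -/
def sectorEpsFun (μ : ℝ) : (ℝ × ℝ × ℝ) × ℝ → ℝ := fun p => sqDispersion (sectorChartPoint μ p.1 p.2) - μ

/-- **The rescaled dispersion** `Ẽ = Q(Q(sectorEpsFun))` (second-order difference quotient in `s`):
`ε(k) - μ = s² Ẽ`, smooth down to `s = 0` — the `γ^{-h}(E_h(k⃗) - μ) = O(1)` of BGM. [cite: BenfattoGiulianiMastropietro2006, §2.5 Lemma 2.2] -/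
def rescaledDispersion (μ : ℝ) : (ℝ × ℝ × ℝ) × ℝ → ℝ := slopeQuot (slopeQuot (sectorEpsFun μ))

section Dispersion

variable {μ : ℝ} (hμ₁ : -4 < μ) (hμ₂ : μ < -2 - Real.sqrt 2)
include hμ₁ hμ₂

/-- `sectorEpsFun` is smooth. [folklore] -/
theorem contDiff_sectorEpsFun : ContDiff ℝ ∞ (sectorEpsFun μ) :=
  (contDiff_sqDispersion.comp (contDiff_uncurry_sectorChartPoint hμ₁ hμ₂)).sub contDiff_const

/-- **`p_F(θ₀)` lies on the Fermi curve**: `sectorEpsFun (x, 0) = 0`. [cite: BenfattoGiulianiMastropietro2006, §2.5 (2.46)] -/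
theorem sectorEpsFun_zero (x : ℝ × ℝ × ℝ) : sectorEpsFun μ (x, 0) = 0 := by
  simp only [sectorEpsFun, sectorChartPoint_zero, sqDispersion, Matrix.cons_val_zero, Matrix.cons_val_one]
  linarith [sqDispersion_fermiXY hμ₁ hμ₂ x.1]

/-- The slice `s ↦ sectorEpsFun (x, s)` has derivative `0` at `s = 0` (**tangency**: `∇ε(p_F(θ₀))·τ(θ₀) = 0`,
BGM (2.53)). [cite: BenfattoGiulianiMastropietro2006, §2.5 (2.53)] -/
theorem hasDerivAt_sectorEpsFun_slice_zero (x : ℝ × ℝ × ℝ) : HasDerivAt (fun s : ℝ => sectorEpsFun μ (x, s)) 0 0 := by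
  obtain ⟨θ₀, a, b⟩ := x
  -- derivatives of the two components of the chart point at `s = 0`
  have h0 : HasDerivAt (fun s : ℝ => sectorChartPoint μ (θ₀, a, b) s 0) (b * fermiTangent μ θ₀ 0) 0 := by
    simp only [sectorChartPoint_apply_zero]
    have := (((hasDerivAt_pow 2 (0 : ℝ)).mul_const a).mul_const (fermiNormal μ θ₀ 0)).add
      (((hasDerivAt_id (0 : ℝ)).mul_const b).mul_const (fermiTangent μ θ₀ 0))
    have := this.const_add (fermiX μ θ₀)
    simpa [add_assoc] using this
  have h1 : HasDerivAt (fun s : ℝ => sectorChartPoint μ (θ₀, a, b) s 1) (b * fermiTangent μ θ₀ 1) 0 := by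
    simp only [sectorChartPoint_apply_one]
    have := (((hasDerivAt_pow 2 (0 : ℝ)).mul_const a).mul_const (fermiNormal μ θ₀ 1)).add
      (((hasDerivAt_id (0 : ℝ)).mul_const b).mul_const (fermiTangent μ θ₀ 1))
    have := this.const_add (fermiY μ θ₀)
    simpa [add_assoc] using this
  have hc0 := (Real.hasDerivAt_cos _).comp (0 : ℝ) h0
  have hc1 := (Real.hasDerivAt_cos _).comp (0 : ℝ) h1
  have hsum := ((hc0.add hc1).const_mul (-2 : ℝ)).sub_const μ
  have hval : -2 * (-Real.sin (sectorChartPoint μ (θ₀, a, b) 0 0) * (b * fermiTangent μ θ₀ 0) +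
      -Real.sin (sectorChartPoint μ (θ₀, a, b) 0 1) * (b * fermiTangent μ θ₀ 1)) = 0 := by
    have htan := grad_fermi_dot_fermiTangent hμ₁ hμ₂ θ₀ θ₀
    rw [sub_self, Real.sin_zero, mul_zero, neg_zero] at htan
    simp only [sectorChartPoint_zero, Matrix.cons_val_zero, Matrix.cons_val_one]
    linear_combination b * htan
  rw [hval] at hsum
  have key : (fun s : ℝ => sectorEpsFun μ ((θ₀, a, b), s)) = fun s =>
      -2 * ((Real.cos ∘ fun s => sectorChartPoint μ (θ₀, a, b) s 0) s + (Real.cos ∘ fun s => sectorChartPoint μ (θ₀, a, b) s 1) s) - μ := by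
    funext s; rfl
  rw [key]
  exact hsum

/-- Hence `∂_s sectorEpsFun (x, 0) = 0`. [cite: BenfattoGiulianiMastropietro2006, §2.5 (2.53)] -/
theorem fderiv_sectorEpsFun_zero (x : ℝ × ℝ × ℝ) : fderiv ℝ (sectorEpsFun μ) (x, 0) (0, 1) = 0 := by
  have hdiff : DifferentiableAt ℝ (sectorEpsFun μ) (x, 0) :=
    ((contDiff_sectorEpsFun hμ₁ hμ₂).differentiable (by simp)).differentiableAt
  have hline : HasDerivAt (fun s : ℝ => ((x, s) : (ℝ × ℝ × ℝ) × ℝ)) ((0 : ℝ × ℝ × ℝ), (1 : ℝ)) 0 :=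
    (hasDerivAt_const (0 : ℝ) x).prodMk (hasDerivAt_id 0)
  have hcomp := hdiff.hasFDerivAt.comp_hasDerivAt (0 : ℝ) hline
  have huniq := hcomp.unique (hasDerivAt_sectorEpsFun_slice_zero hμ₁ hμ₂ x)
  exact huniq

/-- `Ẽ` is smooth. [folklore] -/
theorem contDiff_rescaledDispersion : ContDiff ℝ ∞ (rescaledDispersion μ) :=
  contDiff_slopeQuot_infty (contDiff_slopeQuot_infty (contDiff_sectorEpsFun hμ₁ hμ₂))

/-- **`ε(k) - μ = s² Ẽ`**: the second-order vanishing at `s = 0`. [cite: BenfattoGiulianiMastropietro2006, §2.5 Lemma 2.2] -/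
theorem sectorEpsFun_eq_sq_mul_rescaledDispersion (x : ℝ × ℝ × ℝ) (s : ℝ) :
    sectorEpsFun μ (x, s) = s ^ 2 * rescaledDispersion μ (x, s) := by
  have h := eq_add_add_sq_smul_slopeQuot₂ ((contDiff_sectorEpsFun hμ₁ hμ₂).of_le (by norm_cast)) x s
  rw [sectorEpsFun_zero hμ₁ hμ₂, fderiv_sectorEpsFun_zero hμ₁ hμ₂, smul_zero, zero_add, zero_add, smul_eq_mul] at h
  exact h

end Dispersion

/-! ### The rescaled relative angle -/

/-- The truncation radius `r = ½ √((4+μ)/2)` (half the inner radius of the shells). [folklore] -/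
def truncRadius (μ : ℝ) : ℝ := Real.sqrt ((4 + μ) / 2) / 2

/-- `u = (k₁ + ik₂) e^{-iθ₀}` at the chart point. [folklore] -/
def sectorUFun (μ : ℝ) (x : ℝ × ℝ × ℝ) (s : ℝ) : ℂ := momToComplex (sectorChartPoint μ x s) * exp (-((x.1 : ℝ) * I))

/-- **The truncated relative angle** `sectorAngFun = truncArg r cos(7π/8) cos(15π/16) ∘ u` (globally smooth,
`= arg u` on the sector `{‖u‖ ≥ r, |arg u| ≤ 7π/8}`). [folklore] -/
def sectorAngFun (μ : ℝ) : (ℝ × ℝ × ℝ) × ℝ → ℝ := fun p =>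
  truncArg (truncRadius μ) (Real.cos (7 * π / 8)) (Real.cos (15 * π / 16)) (sectorUFun μ p.1 p.2)

/-- **The rescaled relative angle** `Ã = Q(sectorAngFun)`: `sectorAngFun = s Ã`, smooth down to `s = 0` — the
`γ^{-h/2}(θ(k⃗) - θ_{h,ω}) = O(1)` of BGM. [cite: BenfattoGiulianiMastropietro2006, §2.5 Lemma 2.2] -/
def rescaledAngle (μ : ℝ) : (ℝ × ℝ × ℝ) × ℝ → ℝ := slopeQuot (sectorAngFun μ)

/-- The cut levels are ordered: `cos(15π/16) < cos(7π/8)`. [folklore] -/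
theorem cos_fifteen_lt_cos_seven : Real.cos (15 * π / 16) < Real.cos (7 * π / 8) :=
  Real.cos_lt_cos_of_nonneg_of_le_pi (by positivity) (by linarith [pi_pos]) (by linarith [pi_pos])

/-- `-1 < cos(15π/16)`. [folklore] -/
theorem neg_one_lt_cos_fifteen : -1 < Real.cos (15 * π / 16) := by
  rw [← Real.cos_pi]
  exact Real.cos_lt_cos_of_nonneg_of_le_pi (by positivity) le_rfl (by linarith [pi_pos])

section Angle

variable {μ : ℝ} (hμ₁ : -4 < μ) (hμ₂ : μ < -2 - Real.sqrt 2)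
include hμ₁ hμ₂

omit hμ₂ in
/-- `0 < r`. [folklore] -/
theorem truncRadius_pos : 0 < truncRadius μ := by
  unfold truncRadius
  have : 0 < (4 + μ) / 2 := by linarith
  positivity

/-- `u` depends smoothly on `(θ₀, a, b, s)`. [folklore] -/
theorem contDiff_uncurry_sectorUFun : ContDiff ℝ ∞ (uncurry (sectorUFun μ)) := by
  have h1 : ContDiff ℝ ∞ fun p : (ℝ × ℝ × ℝ) × ℝ => momToComplex (sectorChartPoint μ p.1 p.2) :=
    contDiff_momToComplex.comp (contDiff_uncurry_sectorChartPoint hμ₁ hμ₂)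
  have h2 : ContDiff ℝ ∞ fun p : (ℝ × ℝ × ℝ) × ℝ => exp (-((p.1.1 : ℝ) * I)) := by
    refine (Complex.contDiff_exp (𝕜 := ℝ)).comp ?_
    exact ((Complex.ofRealCLM.contDiff.comp (contDiff_fst.comp contDiff_fst)).mul contDiff_const).neg
  exact h1.mul h2

/-- `sectorAngFun` is smooth. [folklore] -/
theorem contDiff_sectorAngFun : ContDiff ℝ ∞ (sectorAngFun μ) :=
  (contDiff_truncArg (truncRadius_pos hμ₁) cos_fifteen_lt_cos_seven neg_one_lt_cos_fifteen).comp
    (contDiff_uncurry_sectorUFun hμ₁ hμ₂)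

omit hμ₁ hμ₂ in
/-- **At `s = 0`, `u = u(θ₀) > 0`** (the Fermi radius, a positive real number). [folklore] -/
theorem sectorUFun_zero (x : ℝ × ℝ × ℝ) : sectorUFun μ x 0 = (fermiRadius μ x.1 : ℂ) := by
  have h1 : momToComplex ![fermiX μ x.1, fermiY μ x.1] = (fermiRadius μ x.1 : ℂ) * exp ((x.1 : ℂ) * I) := by
    apply Complex.ext
    · simp [fermiX, Complex.exp_ofReal_mul_I_re]
    · simp [fermiY, Complex.exp_ofReal_mul_I_im]
  rw [sectorUFun, sectorChartPoint_zero, h1, mul_assoc, ← Complex.exp_add, add_neg_cancel, Complex.exp_zero, mul_one]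

/-- Hence `sectorAngFun (x, 0) = 0`. [folklore] -/
theorem sectorAngFun_zero (x : ℝ × ℝ × ℝ) : sectorAngFun μ (x, 0) = 0 := by
  simp only [sectorAngFun, sectorUFun_zero, truncArg, Complex.arg_ofReal_of_nonneg (fermiRadius_pos hμ₁ hμ₂ x.1).le,
    mul_zero]

/-- `Ã` is smooth. [folklore] -/
theorem contDiff_rescaledAngle : ContDiff ℝ ∞ (rescaledAngle μ) :=
  contDiff_slopeQuot_infty (contDiff_sectorAngFun hμ₁ hμ₂)

/-- **`sectorAngFun = s Ã`**: the first-order vanishing at `s = 0`. [cite: BenfattoGiulianiMastropietro2006, §2.5 Lemma 2.2] -/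
theorem sectorAngFun_eq_mul_rescaledAngle (x : ℝ × ℝ × ℝ) (s : ℝ) :
    sectorAngFun μ (x, s) = s * rescaledAngle μ (x, s) := by
  have h := eq_add_smul_slopeQuot (contDiff_sectorAngFun hμ₁ hμ₂) (by simp) x s
  rw [sectorAngFun_zero hμ₁ hμ₂, zero_add, smul_eq_mul] at h
  exact h

omit hμ₁ hμ₂ in
/-- `‖u‖ = ‖k‖`. [folklore] -/
theorem norm_sectorUFun (x : ℝ × ℝ × ℝ) (s : ℝ) : ‖sectorUFun μ x s‖ = ‖momToComplex (sectorChartPoint μ x s)‖ := by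
  rw [sectorUFun, norm_mul, show -((x.1 : ℂ) * I) = ((-x.1 : ℝ) : ℂ) * I by push_cast; ring,
    Complex.norm_exp_ofReal_mul_I, mul_one]

omit hμ₁ hμ₂ in
/-- `arg u` is the relative angle of the chart point. [folklore] -/
theorem arg_sectorUFun (x : ℝ × ℝ × ℝ) (s : ℝ) : arg (sectorUFun μ x s) = sectorRelAngle x.1 (sectorChartPoint μ x s) := rfl

end Angle

end Literature.MathematicalPhysics.QuantumLattice

end
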